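import Summits.MatrixMultiplication.OmegaCensus.STPPVosperSlackPairingGauge
import Summits.MatrixMultiplication.OmegaCensus.STPPVosperTilingWordsPrunedSets
import Summits.MatrixMultiplication.OmegaCensus.STPPVosperTilingWordsEnumExtract
import Summits.MatrixMultiplication.OmegaCensus.STPPCertificateCheck
import Literature.Computability.AlgebraicComplexity.STPPLineFamilies

/-!
# ω-census (abelian STPP census): 'CoreB' — the π-free FULL-FAMILY Def-5.1 stage for one-other-block leaves, and its extraction (kernel)

HONEST FRAMING (pub-omega census; verbatim): lottery ticket; floor = certified bounds/negative ranges.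
Census STRUCTURE (seat pub-omega-stpp-2 gen 26, 2026-08-28; RULING L37-135), family (b2).  Last stage of the slack-`s` partition law on a leaf with ONE other
block `o` (seat stpp-1's SLACK2-DESIGN.md; e.g. `{(3,3,3),(3,3,4)} @ ℤ₆₁`, where 18 of 1 206 case-A configurations survive the cover+words stage with 3 exact
realisations each and only the two-block Def-5.1 test kills them — HOME `pub-omega-stpp-2-g26/code/s2/caseA_words.py`).  GAUGE (all symmetries of Def 5.1,
`isSTPP_gauge`): dilate by `u` (`u e′ = 1`); translate block `i` by `−uβ` and block `o` by `−u b*` (`b* ∈ B_o`); shift all `A`-sets by `u(z₀ − y₀)` and all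
`C`-sets by `−u y₀`.  Then `B′ᵢ = BD`, `A′ᵢ = ζ − AD·j` (`j = (u d).val`, `ζ = u(z₀ − y₀ − s₀ − β)`), `C′ᵢ = (anchors of the pairing stage) − κ`
(`κ = w + u s₀ + u y₀`), `0 ∈ B′ₒ`, `C′ₒ − B′ₒ` has the value list `YL` and `C′ₒ − A′ₒ` the value list `ZL` — so block `o` is a member of
`blockSetsWQ p YL ZL aₒ bₒ cₒ` (`STPPVosperTilingWordsPrunedSets.lean`) and `C′ᵢ + κ` a member of `anchorsFk …` (`STPPVosperSlackPairingGauge.lean`).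
`stageB` runs `stppCheck` (the tree's Bool Def-5.1 transcription, `STPPCertificateCheck.lean`) on every such two-block candidate; `stageB_of_isSTPP`: a real
family makes it return `true`.  A leaf kill decides `stageB … = false`.  The offsets `ζ.val`, `κ.val` are inputs (explicit in the table parameters of each
case, e.g. slack-1 case γ: `κ = t`, `ζ = (b + n − 1) − t`).  Nothing here is progress on `ω`.

References: H. Cohn, R. Kleinberg, B. Szegedy, C. Umans, FOCS 2005 (arXiv:math/0511460), Def. 5.1.
-/

open Finset
open scoped Pointwise

namespace Summit.MatrixMultiplication.OmegaCensus.CubeNB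

open Literature.Computability.AlgebraicComplexity
open Literature.Combinatorics.Additive
open Summit.MatrixMultiplication.OmegaCensus.STPPKneser

/-! ## §1 The test -/

section Test

/-- **Full-family Def-5.1 stage** (`Bool`).  For every listed anchor set `X` (candidate `C′ᵢ + κ`) and every realisation `(Aₒ, Bₒ, Cₒ)` of the other block
against the value lists `YL`, `(ZL + zs) mod p` (`blockSetsWQ`), run `stppCheck` on the two-block family `(block o, block i)` with
`A′ᵢ = {zs − ε·j}`, `B′ᵢ = BD`, `C′ᵢ = X − kv` (residues of `ℤ/p`); `true` iff some candidate passes. [cite: CohnKleinbergSzegedyUmans2005, Def. 5.1] -/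
def stageB (p : ℕ) (AD BD : Finset ℕ) (j : ℕ) (YL ZL : List ℕ) (zs kv ao bo co : ℕ) (anchorSets : List (Finset ℕ)) : Bool :=
  anchorSets.any fun X =>
    (blockSetsWQ p YL ZL ao bo co).any fun ABC =>
      stppCheck (H := ZMod p)
        ![ABC.1.map (fun x : ℕ => (x : ZMod p)), (AD.sort (· ≤ ·)).map fun ε : ℕ => (zs : ZMod p) - (ε : ZMod p) * (j : ZMod p)]
        ![ABC.2.1.map (fun x : ℕ => (x : ZMod p)), (BD.sort (· ≤ ·)).map fun δ : ℕ => (δ : ZMod p)]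
        ![ABC.2.2.map (fun x : ℕ => (x : ZMod p)), (X.sort (· ≤ ·)).map fun x : ℕ => (x : ZMod p) - (kv : ZMod p)]

end Test

/-! ## §2 Soundness of `stppCheck` in the other direction, and list/finset bookkeeping -/

section Check

/-- **Completeness of `stppCheck`.**  If the finsets enumerated by the lists form an STPP family, the checker accepts the lists.
[cite: CohnKleinbergSzegedyUmans2005, Def. 5.1] -/
theorem stppCheck_of_isSTPP {H : Type*} [AddCommGroup H] [DecidableEq H] {N : ℕ} {LA LB LC : Fin N → List H}
    (h : IsSTPP (fun i => (LA i).toFinset) (fun i => (LB i).toFinset) (fun i => (LC i).toFinset)) : stppCheck LA LB LC = true := by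
  simp only [stppCheck, List.all_eq_true, decide_eq_true_eq]
  intro i _ j _ k _ s hs s' hs' t ht t' ht' u hu u' hu' h0
  exact h i j k s (List.mem_toFinset.2 hs) s' (List.mem_toFinset.2 hs') t (List.mem_toFinset.2 ht) t' (List.mem_toFinset.2 ht')
    u (List.mem_toFinset.2 hu) u' (List.mem_toFinset.2 hu') h0

variable {p : ℕ} [hp : Fact p.Prime]

/-- A list of naturals enumerating the values of a finset of residues casts back to that finset. [folklore] -/
theorem toFinset_map_cast_of_vals {S : Finset (ZMod p)} {L : List ℕ} (hL : ∀ x, x ∈ L ↔ x ∈ S.image ZMod.val) :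
    (L.map fun x : ℕ => (x : ZMod p)).toFinset = S := by
  ext y
  rw [List.mem_toFinset, List.mem_map]
  constructor
  · rintro ⟨x, hx, rfl⟩
    obtain ⟨z, hz, rfl⟩ := Finset.mem_image.1 ((hL x).1 hx)
    rw [ZMod.natCast_zmod_val]; exact hz
  · intro hy
    exact ⟨y.val, (hL _).2 (Finset.mem_image.2 ⟨y, hy, rfl⟩), ZMod.natCast_zmod_val y⟩

omit hp in
/-- The sorted list of a finset of naturals, mapped, enumerates the mapped finset. [folklore] -/
theorem toFinset_map_sort (S : Finset ℕ) (f : ℕ → ZMod p) : ((S.sort (· ≤ ·)).map f).toFinset = S.image f := by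
  ext y
  simp [List.mem_toFinset, List.mem_map, Finset.mem_image, Finset.mem_sort]

end Check

/-! ## §3 Extraction -/

section Extract

variable {p : ℕ} [hp : Fact p.Prime] {N : ℕ} {A B C : Fin N → Finset (ZMod p)}

/-- **A real family passes the full-family stage.**  STPP family, block `i`, the other block `o` (`(univ.erase i) = {o}`), shape data of block `i`
(`−Aᵢ = {s₀ + ε•d : ε ∈ AD}`, `Bᵢ = {β + δ•e′ : δ ∈ BD}`, `u e′ = 1`), a set `R ⊇ W` with `#R ≤ #W + k` transported by `x ↦ u x + w`, duplicate-free value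
lists `YL`, `ZL` of `Y° = Cₒ − Bₒ`, `Z° = Cₒ − Aₒ` relative to `y₀`, `z₀`, and the two offsets `zs = (u(z₀ − y₀ − s₀ − β)).val`, `kv = (w + u s₀ + u y₀).val`:
then `stageB … (anchorsFk …) = true`. [cite: CohnKleinbergSzegedyUmans2005, Def. 5.1] -/
theorem stageB_of_isSTPP (hS : IsSTPP A B C) (hA : ∀ k, (A k).Nonempty) (hB : ∀ k, (B k).Nonempty) (hC : ∀ k, (C k).Nonempty)
    (i o : Fin N) (hoi : o ≠ i) (hUo : (univ : Finset (Fin N)).erase i = {o})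
    {u e' d s₀ β w y₀ z₀ : ZMod p} (hue : u * e' = 1) {AD BD : Finset ℕ} (hADne : AD.Nonempty) (hBDne : BD.Nonempty)
    (hAD : ∀ ε ∈ AD, ε < p) (hBD : ∀ δ ∈ BD, δ < p)
    (hSn : (A i).image (fun x => (0 : ZMod p) - x) = AD.image fun ε : ℕ => s₀ + ε • d) (hBi : B i = BD.image fun δ : ℕ => β + δ • e')
    {R : Finset (ZMod p)} {k fuel : ℕ}
    (hWR : (((A i) ×ˢ ((B i) ×ˢ (C i))).image fun q : ZMod p × ZMod p × ZMod p => (0 : ZMod p) + q.2.2 - q.1 - q.2.1) ⊆ R)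
    (hRk : #R ≤ #((((A i) ×ˢ ((B i) ×ˢ (C i))).image fun q : ZMod p × ZMod p × ZMod p => (0 : ZMod p) + q.2.2 - q.1 - q.2.1)) + k)
    (hfuel : #(C i) + k ≤ fuel) {YL ZL : List ℕ} (hYL : YL.Nodup)
    (hY1 : ∀ x ∈ DU B C (univ.erase i), (u * (x - y₀)).val ∈ YL) (hY2 : ∀ t ∈ YL, ∃ x ∈ DU B C (univ.erase i), (u * (x - y₀)).val = t)
    (hZ1 : ∀ x ∈ DU A C (univ.erase i), (u * (x - z₀)).val ∈ ZL) (hZ2 : ∀ t ∈ ZL, ∃ x ∈ DU A C (univ.erase i), (u * (x - z₀)).val = t)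
    {zs kv : ℕ} (hzs : (u * (z₀ - y₀ - s₀ - β)).val = zs) (hkv : (w + u * s₀ + u * y₀).val = kv) :
    stageB p AD BD (u * d).val YL ZL zs kv #(A o) #(B o) #(C o)
      (anchorsFk p (patN2 p (u * d).val AD BD) fuel k ((R.image fun x => u * x + w).image ZMod.val)) = true := by
  have hu0 : u ≠ 0 := fun h => by rw [h, zero_mul] at hue; exact zero_ne_one hue
  have hvinj : Function.Injective (ZMod.val : ZMod p → ℕ) := ZMod.val_injective p
  obtain ⟨bs, hbs⟩ := hB o
  -- the gauge
  set gA : ZMod p := u * z₀ - u * y₀ with hgA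
  set gC : ZMod p := -(u * y₀) with hgC
  set tt : Fin N → ZMod p := fun k' => if k' = i then -(u * β) else -(u * bs) with htt
  have hG := (isSTPP_gauge hS hu0 tt gA 0 gC).comp_of_injective (![o, i] : Fin 2 → Fin N) (by
    intro x y hxy
    fin_cases x <;> fin_cases y
    · rfl
    · exact absurd hxy hoi
    · exact absurd hxy.symm hoi
    · rfl)
  have htto : tt o = -(u * bs) := by simp [htt, hoi]
  have htti : tt i = -(u * β) := by simp [htt]
  -- block o in the gauge, as value finsets
  set φA : ZMod p → ZMod p := fun x => u * x + (tt o + gA) with hφA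
  set φB : ZMod p → ZMod p := fun x => u * x + (tt o + 0) with hφB
  set φC : ZMod p → ZMod p := fun x => u * x + (tt o + gC) with hφC
  set Av := ((A o).image φA).image ZMod.val with hAv
  set Bv := ((B o).image φB).image ZMod.val with hBv
  set Cv := ((C o).image φC).image ZMod.val with hCv
  have hinjφA : Function.Injective φA := affine_injective hu0 _
  have hinjφB : Function.Injective φB := affine_injective hu0 _
  have hinjφC : Function.Injective φC := affine_injective hu0 _
  -- differences of gauge values
  have hdCB : ∀ c₀ b₀ : ZMod p, ((φC c₀).val + p - (φB b₀).val) % p = (u * (c₀ - b₀ - y₀)).val := by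
    intro c₀ b₀; rw [← val_sub_eq_mod]; congr 1; simp only [hφC, hφB, hgC]; ring
  have hdCA : ∀ c₀ a₀ : ZMod p, ((φC c₀).val + p - (φA a₀).val) % p = (u * (c₀ - a₀ - z₀)).val := by
    intro c₀ a₀; rw [← val_sub_eq_mod]; congr 1; simp only [hφC, hφA, hgC, hgA]; ring
  have hdAB : ∀ a₀ b₀ : ZMod p, ((φA a₀).val + p - (φB b₀).val) % p = (u * (a₀ - b₀ - y₀ + z₀)).val := by
    intro a₀ b₀; rw [← val_sub_eq_mod]; congr 1; simp only [hφA, hφB, hgA]; ring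
  -- Y°, Z° are the difference sets of block o alone
  have hYo : DU B C (univ.erase i) = D B C o := by rw [hUo]; simp [DU]
  have hZo : DU A C (univ.erase i) = D A C o := by rw [hUo]; simp [DU]
  have hYmem : ∀ c₀ ∈ C o, ∀ b₀ ∈ B o, c₀ - b₀ ∈ DU B C (univ.erase i) := fun c₀ hc₀ b₀ hb₀ => by
    rw [hYo]; exact mem_D.2 ⟨b₀, hb₀, c₀, hc₀, rfl⟩
  have hZmem : ∀ c₀ ∈ C o, ∀ a₀ ∈ A o, c₀ - a₀ ∈ DU A C (univ.erase i) := fun c₀ hc₀ a₀ ha₀ => by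
    rw [hZo]; exact mem_D.2 ⟨a₀, ha₀, c₀, hc₀, rfl⟩
  have hYL_to : ∀ wv : ZMod p, (u * (wv - y₀)).val ∈ YL → ∃ b₃ ∈ B o, ∃ c₃ ∈ C o, c₃ - b₃ = wv := by
    intro wv hw
    obtain ⟨x, hx, hxw⟩ := hY2 _ hw
    have h1 : x = wv := by have := mul_left_cancel₀ hu0 (hvinj hxw); linear_combination this
    rw [hYo] at hx; subst h1; exact mem_D.1 hx
  have hZL_to : ∀ wv : ZMod p, (u * (wv - z₀)).val ∈ ZL → ∃ a₃ ∈ A o, ∃ c₃ ∈ C o, c₃ - a₃ = wv := by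
    intro wv hw
    obtain ⟨x, hx, hxw⟩ := hZ2 _ hw
    have h1 : x = wv := by have := mul_left_cancel₀ hu0 (hvinj hxw); linear_combination this
    rw [hZo] at hx; subst h1; exact mem_D.1 hx
  -- block o realises (YL, ZL): the hypotheses of `blockSetsWQ_complete`
  obtain ⟨Al, Bl, Cl, hAl, hBl, hCl, hmem⟩ := blockSetsWQ_complete p YL ZL hYL #(A o) #(B o) #(C o) Av Bv Cv
    (by rw [hAv, Finset.card_image_of_injective _ hvinj, Finset.card_image_of_injective _ hinjφA])
    (by rw [hBv, Finset.card_image_of_injective _ hvinj, Finset.card_image_of_injective _ hinjφB])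
    (by rw [hCv, Finset.card_image_of_injective _ hvinj, Finset.card_image_of_injective _ hinjφC])
    (fun x hx => by obtain ⟨y, -, rfl⟩ := Finset.mem_image.1 hx; exact ZMod.val_lt _)
    (fun x hx => by obtain ⟨y, -, rfl⟩ := Finset.mem_image.1 hx; exact ZMod.val_lt _)
    (fun x hx => by obtain ⟨y, -, rfl⟩ := Finset.mem_image.1 hx; exact ZMod.val_lt _)
    (Finset.mem_image.2 ⟨φB bs, Finset.mem_image.2 ⟨bs, hbs, rfl⟩, by simp [hφB, htto]⟩)
    (by
      intro c hc x hx
      obtain ⟨c', hc', rfl⟩ := Finset.mem_image.1 hc; obtain ⟨c₀, hc₀, rfl⟩ := Finset.mem_image.1 hc'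
      obtain ⟨x', hx', rfl⟩ := Finset.mem_image.1 hx; obtain ⟨b₀, hb₀, rfl⟩ := Finset.mem_image.1 hx'
      rw [hdCB]; exact hY1 _ (hYmem c₀ hc₀ b₀ hb₀))
    (by
      intro c hc x hx
      obtain ⟨c', hc', rfl⟩ := Finset.mem_image.1 hc; obtain ⟨c₀, hc₀, rfl⟩ := Finset.mem_image.1 hc'
      obtain ⟨x', hx', rfl⟩ := Finset.mem_image.1 hx; obtain ⟨a₀, ha₀, rfl⟩ := Finset.mem_image.1 hx'
      rw [hdCA]; exact hZ1 _ (hZmem c₀ hc₀ a₀ ha₀))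
    (by
      intro c hc c' hc' x hx x' hx' heq
      obtain ⟨c₁, hc₁, rfl⟩ := Finset.mem_image.1 hc; obtain ⟨c₀, hc₀, rfl⟩ := Finset.mem_image.1 hc₁
      obtain ⟨c₂, hc₂, rfl⟩ := Finset.mem_image.1 hc'; obtain ⟨c₀', hc₀', rfl⟩ := Finset.mem_image.1 hc₂
      obtain ⟨x₁, hx₁, rfl⟩ := Finset.mem_image.1 hx; obtain ⟨b₀, hb₀, rfl⟩ := Finset.mem_image.1 hx₁
      obtain ⟨x₂, hx₂, rfl⟩ := Finset.mem_image.1 hx'; obtain ⟨b₀', hb₀', rfl⟩ := Finset.mem_image.1 hx₂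
      rw [hdCB, hdCB] at heq
      have h1 : c₀ - b₀ = c₀' - b₀' := by have := mul_left_cancel₀ hu0 (hvinj heq); linear_combination this
      obtain ⟨e1, e2⟩ := sub_injOn_of_card_D (card_D_BC hS hA o) hb₀ hb₀' hc₀ hc₀' h1
      exact ⟨by rw [e2], by rw [e1]⟩)
    (by
      intro c hc c' hc' x hx x' hx' heq
      obtain ⟨c₁, hc₁, rfl⟩ := Finset.mem_image.1 hc; obtain ⟨c₀, hc₀, rfl⟩ := Finset.mem_image.1 hc₁
      obtain ⟨c₂, hc₂, rfl⟩ := Finset.mem_image.1 hc'; obtain ⟨c₀', hc₀', rfl⟩ := Finset.mem_image.1 hc₂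
      obtain ⟨x₁, hx₁, rfl⟩ := Finset.mem_image.1 hx; obtain ⟨a₀, ha₀, rfl⟩ := Finset.mem_image.1 hx₁
      obtain ⟨x₂, hx₂, rfl⟩ := Finset.mem_image.1 hx'; obtain ⟨a₀', ha₀', rfl⟩ := Finset.mem_image.1 hx₂
      rw [hdCA, hdCA] at heq
      have h1 : c₀ - a₀ = c₀' - a₀' := by have := mul_left_cancel₀ hu0 (hvinj heq); linear_combination this
      obtain ⟨e1, e2⟩ := sub_injOn_of_card_D (card_D_AC hS hB o) ha₀ ha₀' hc₀ hc₀' h1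
      exact ⟨by rw [e2], by rw [e1]⟩)
    (by
      intro c hc c' hc' x hx x' hx' heq
      obtain ⟨c₁, hc₁, rfl⟩ := Finset.mem_image.1 hc; obtain ⟨a₀, ha₀, rfl⟩ := Finset.mem_image.1 hc₁
      obtain ⟨c₂, hc₂, rfl⟩ := Finset.mem_image.1 hc'; obtain ⟨a₀', ha₀', rfl⟩ := Finset.mem_image.1 hc₂
      obtain ⟨x₁, hx₁, rfl⟩ := Finset.mem_image.1 hx; obtain ⟨b₀, hb₀, rfl⟩ := Finset.mem_image.1 hx₁
      obtain ⟨x₂, hx₂, rfl⟩ := Finset.mem_image.1 hx'; obtain ⟨b₀', hb₀', rfl⟩ := Finset.mem_image.1 hx₂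
      rw [hdAB, hdAB] at heq
      have h1 : b₀ - a₀ = b₀' - a₀' := by have := mul_left_cancel₀ hu0 (hvinj heq); linear_combination (-1 : ZMod p) * this
      obtain ⟨e1, e2⟩ := sub_injOn_of_card_D (card_D_AB hS hC o) ha₀ ha₀' hb₀ hb₀' h1
      exact ⟨by rw [e1], by rw [e2]⟩)
    (by
      intro x₁ hx₁ x₂ hx₂ hne y₁ hy₁ c hc hmem'
      obtain ⟨x₁', hx₁', rfl⟩ := Finset.mem_image.1 hx₁; obtain ⟨a₁, ha₁, rfl⟩ := Finset.mem_image.1 hx₁'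
      obtain ⟨x₂', hx₂', rfl⟩ := Finset.mem_image.1 hx₂; obtain ⟨a₂, ha₂, rfl⟩ := Finset.mem_image.1 hx₂'
      obtain ⟨y₁', hy₁', rfl⟩ := Finset.mem_image.1 hy₁; obtain ⟨b₁, hb₁, rfl⟩ := Finset.mem_image.1 hy₁'
      obtain ⟨c', hc', rfl⟩ := Finset.mem_image.1 hc; obtain ⟨c₂, hc₂, rfl⟩ := Finset.mem_image.1 hc'
      have hword : (((φA a₁).val + p - (φB b₁).val) % p + ((φC c₂).val + p - (φA a₂).val) % p) % p = (u * ((a₁ - b₁ + c₂ - a₂) - y₀)).val := by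
        rw [hdAB, hdCA, ← ZMod.val_add]; congr 1; ring
      rw [hword] at hmem'
      obtain ⟨b₃, hb₃, c₃, hc₃, h3⟩ := hYL_to _ hmem'
      obtain ⟨-, -, h4, -, -⟩ := hS o o o a₂ ha₂ a₁ ha₁ b₁ hb₁ b₃ hb₃ c₃ hc₃ c₂ hc₂ (by linear_combination (-1 : ZMod p) * h3)
      exact hne (by rw [h4]))
    (by
      intro y₁ hy₁ y₂ hy₂ hne c hc x hx hmem'
      obtain ⟨y₁', hy₁', rfl⟩ := Finset.mem_image.1 hy₁; obtain ⟨b₁, hb₁, rfl⟩ := Finset.mem_image.1 hy₁'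
      obtain ⟨y₂', hy₂', rfl⟩ := Finset.mem_image.1 hy₂; obtain ⟨b₂, hb₂, rfl⟩ := Finset.mem_image.1 hy₂'
      obtain ⟨c', hc', rfl⟩ := Finset.mem_image.1 hc; obtain ⟨c₁, hc₁, rfl⟩ := Finset.mem_image.1 hc'
      obtain ⟨x', hx', rfl⟩ := Finset.mem_image.1 hx; obtain ⟨a₂, ha₂, rfl⟩ := Finset.mem_image.1 hx'
      have hword : (((φC c₁).val + p - (φB b₁).val) % p + p - ((φA a₂).val + p - (φB b₂).val) % p) % p =
          (u * ((c₁ - b₁ - a₂ + b₂) - z₀)).val := by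
        rw [hdCB, hdAB, ← val_sub_eq_mod]; congr 1; ring
      rw [hword] at hmem'
      obtain ⟨a₃, ha₃, c₃, hc₃, h3⟩ := hZL_to _ hmem'
      obtain ⟨-, -, -, h4, -⟩ := hS o o o a₃ ha₃ a₂ ha₂ b₂ hb₂ b₁ hb₁ c₁ hc₁ c₃ hc₃ (by linear_combination h3)
      exact hne (by rw [h4]))
    (by
      intro c hc c' hc' hne y₁ hy₁ x hx x' hx' y' hy' heq
      obtain ⟨c₁', hc₁', rfl⟩ := Finset.mem_image.1 hc; obtain ⟨c₁, hc₁, rfl⟩ := Finset.mem_image.1 hc₁'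
      obtain ⟨c₂', hc₂', rfl⟩ := Finset.mem_image.1 hc'; obtain ⟨c₂, hc₂, rfl⟩ := Finset.mem_image.1 hc₂'
      obtain ⟨y₁', hy₁', rfl⟩ := Finset.mem_image.1 hy₁; obtain ⟨b₁, hb₁, rfl⟩ := Finset.mem_image.1 hy₁'
      obtain ⟨x₁', hx₁', rfl⟩ := Finset.mem_image.1 hx; obtain ⟨a₂, ha₂, rfl⟩ := Finset.mem_image.1 hx₁'
      obtain ⟨x₂', hx₂', rfl⟩ := Finset.mem_image.1 hx'; obtain ⟨a₃, ha₃, rfl⟩ := Finset.mem_image.1 hx₂'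
      obtain ⟨y₂', hy₂', rfl⟩ := Finset.mem_image.1 hy'; obtain ⟨b₃, hb₃, rfl⟩ := Finset.mem_image.1 hy₂'
      have hword : (((φC c₁).val + p - (φB b₁).val) % p + p - ((φC c₂).val + p - (φA a₂).val) % p) % p =
          (u * ((c₁ - b₁ - c₂ + a₂) - y₀ + z₀)).val := by
        rw [hdCB, hdCA, ← val_sub_eq_mod]; congr 1; ring
      rw [hword, hdAB] at heq
      have h3 : c₁ - b₁ - c₂ + a₂ = a₃ - b₃ := by have := mul_left_cancel₀ hu0 (hvinj heq); linear_combination this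
      obtain ⟨-, -, -, -, h5⟩ := hS o o o a₂ ha₂ a₃ ha₃ b₃ hb₃ b₁ hb₁ c₁ hc₁ c₂ hc₂ (by linear_combination (-1 : ZMod p) * h3)
      exact hne (by rw [h5]))
  -- the anchor set of block i
  have hX₀ := anchorsFk_blockSum2 hS i (w := w) hue hADne hBDne hAD hBD hSn hBi hWR hRk hfuel
  -- assemble
  rw [stageB, List.any_eq_true]
  refine ⟨_, hX₀, ?_⟩
  rw [List.any_eq_true]
  refine ⟨(Al, Bl, Cl), hmem, ?_⟩
  apply stppCheck_of_isSTPP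
  -- identify the candidate family with the gauge family restricted to (o, i)
  have eAo : (Al.map fun x : ℕ => (x : ZMod p)).toFinset = (A o).image φA := toFinset_map_cast_of_vals hAl
  have eBo : (Bl.map fun x : ℕ => (x : ZMod p)).toFinset = (B o).image φB := toFinset_map_cast_of_vals hBl
  have eCo : (Cl.map fun x : ℕ => (x : ZMod p)).toFinset = (C o).image φC := toFinset_map_cast_of_vals hCl
  have eAi : ((AD.sort (· ≤ ·)).map fun ε : ℕ => (zs : ZMod p) - (ε : ZMod p) * ((u * d).val : ZMod p)).toFinset =
      (A i).image fun x => u * x + (tt i + gA) := by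
    rw [toFinset_map_sort, htti]
    have hAi : A i = AD.image fun ε : ℕ => -(s₀ + ε • d) := by
      have h1 : A i = ((A i).image fun x => (0 : ZMod p) - x).image fun x => (0 : ZMod p) - x := by
        rw [Finset.image_image]; convert (Finset.image_id (s := A i)).symm using 2; funext x; simp
      rw [h1, hSn, Finset.image_image]; refine Finset.image_congr fun ε _ => ?_; simp
    rw [hAi, Finset.image_image]
    refine Finset.image_congr fun ε _ => ?_
    simp only [Function.comp_apply, ZMod.natCast_val, ZMod.cast_id', id_eq, nsmul_eq_mul, hgA]
    rw [← hzs, ZMod.natCast_zmod_val]; ring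
  have eBi : ((BD.sort (· ≤ ·)).map fun δ : ℕ => (δ : ZMod p)).toFinset = (B i).image fun x => u * x + (tt i + 0) := by
    rw [toFinset_map_sort, htti, hBi, Finset.image_image]
    refine Finset.image_congr fun δ _ => ?_
    simp only [Function.comp_apply, nsmul_eq_mul]
    linear_combination (-(δ : ZMod p)) * hue
  have eCi : ((((C i).image fun c => (u * c + w + u * s₀ - u * β).val).sort (· ≤ ·)).map
      (fun x : ℕ => (x : ZMod p) - (kv : ZMod p))).toFinset = (C i).image fun x => u * x + (tt i + gC) := by
    rw [toFinset_map_sort, Finset.image_image, htti, hgC]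
    refine Finset.image_congr fun c _ => ?_
    simp only [Function.comp_apply, ZMod.natCast_val, ZMod.cast_id', id_eq]
    rw [← hkv, ZMod.natCast_zmod_val]; ring
  have hfam : IsSTPP (fun m : Fin 2 => (![(Al.map fun x : ℕ => (x : ZMod p)),
        (AD.sort (· ≤ ·)).map fun ε : ℕ => (zs : ZMod p) - (ε : ZMod p) * ((u * d).val : ZMod p)] m).toFinset)
      (fun m : Fin 2 => (![(Bl.map fun x : ℕ => (x : ZMod p)), (BD.sort (· ≤ ·)).map fun δ : ℕ => (δ : ZMod p)] m).toFinset)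
      (fun m : Fin 2 => (![(Cl.map fun x : ℕ => (x : ZMod p)),
        (((C i).image fun c => (u * c + w + u * s₀ - u * β).val).sort (· ≤ ·)).map fun x : ℕ => (x : ZMod p) - (kv : ZMod p)] m).toFinset) := by
    convert hG using 1 <;> funext m <;> fin_cases m
    · exact eAo
    · exact eAi
    · exact eBo
    · exact eBi
    · exact eCo
    · exact eCi
  exact hfam

end Extract

end Summit.MatrixMultiplication.OmegaCensus.CubeNB
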